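import Summits.BirchSwinnertonDyer.BirchSwinnertonDyer.Theorems.QuadraticBranchSignedControlPlusKatoDivisibilityOfEulerSystemBoundRows
import Summits.BirchSwinnertonDyer.BirchSwinnertonDyer.Theorems.QuadraticBranchSignedControlGss2Assembly
import HarnessLib

/-!
# K8 item 19241 `PlusKatoDivisibilityBranch` BY NAME, part 3 (leaf): the rung leaf `O5SharpGss` from the
# three named facts `{thm62_63_73_etaColemanPoitouTate_zeta, Kato Thm. 13.4, Kobayashi Thm. 1.2}`,
# the route's three genuinely OPEN cruxes (19242 Eisenstein inclusion on the onto locus, 19243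
# non-surjective residual, 19116 p-adic Gross–Zagier) and its held published inputs — with item 19241
# (Kato half), item 19115 (`EtaTransportSigned`) and the support `Gss2Assembly` DISCHARGED by name

Cell `bsd-potss` (HOME `run/shared/lean/pub/bsd-potss/`), seat `bsd-potss-k8q-c2x` g2 (prover; WIDTH-LEVER
second lane of item stmt-BirchSwinnertonDyer-19241 `PlusKatoDivisibilityBranch`, rung K8-Gss2, route
`QuadraticBranchSignedControl`). HONEST FRAMING: the programme assembles BSD for analytic rank `≤ 1`
strictly from published theorems and types the remainder; BSD is not proved by any of this; the theorem
below is CONDITIONAL on named Literature facts AND on the route's open crux items, all displayed as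
hypotheses; the rung leaf is not closed by it; nothing is booked.

Parts 1–2 (same seat, `…PlusKatoDivisibilityOfEulerSystemBound.lean`, `…Rows.lean`) showed that the
route's deciding theorem `closes` consumes `hK : PlusKatoDivisibilityBranch` only on the tower-onto rows
and that there it follows from `hZ` (Kobayashi 2003 Thm. 6.2/6.3/7.3 i)/Cor. 7.2 at `η` with `z` a
genuine Euler-system class), `h134` (Kato 2004 Thm. 13.4, reduction-free) and `h12` (Kobayashi Thm. 1.2).
The SAME fact `hZ` projects onto seat k8q-c3's `thm62_63_73_etaColemanPoitouTate` (forget the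
Euler-system field; the two extra structure binders of `T_pW` are the tree theorems
`module_free_tateModule_holds` / `module_finite_tateModule_holds`), from which the tree already derives
item 19584 `PublishedInputThm74` and the crux 19115 `EtaTransportSigned`
(`Thm74Skeleton.publishedInputThm74_of_etaColemanPoitouTate`, `….etaTransportSigned_of_etaColemanPoitouTate`);
and the support `Gss2Assembly` (19119) is the tree theorem `gss2Assembly_proof`. Hence:

* `EulerSystemBound.publishedInputThm74_of_zeta`, `EulerSystemBound.etaTransportSigned_of_zeta` —
  19584 / 19115 from `hZ` alone;
* `EulerSystemBound.o5SharpGss_of_facts_of_cruxes` — **`O5SharpGss` from `{hZ, h134, h12}` + the open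
  cruxes `hE : PlusLowerInclusionSurjBranch` (19242), `hN : PlusMainConjectureNonsurjBranch` (19243),
  `h₄ : PAdicGrossZagierBranch` (19116) + the held inputs `hP : PublishedInputsGss2`,
  `hKO : PublishedInputKO13`, `hR : Gss2AtThree`** — i.e. `closes` with `hK`, `h₂`, `hG` discharged.
So the K8 route's Kato side AND its `η`-transport rest on ONE Kobayashi package (with the Euler-system
pin) + Kato's general Euler-system theorem + Thm. 1.2, all by name. CM / non-(v) rows of 19241 are not
involved (they are `hN`'s). Nothing here is stronger than print.

References: [Kobayashi2003] Thm. 1.2 (p. 2), Thm. 4.1 (p. 8), Thm. 6.2, 6.3 (p. 11), Thm. 7.3, Thm. 7.4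
and its proof (p. 13); [Kato2004Asterisque] Thm. 13.4 (p. 226); [KitajimaOtsuki2018] Main Thm. 1.3;
[Mazur1978] Cor. 4.1.
-/

noncomputable section

set_option linter.dupNamespace false

open scoped Classical

open CongruenceSubgroup Field WeierstrassCurve
open Literature.NumberTheory.EllipticCurves
open Literature.NumberTheory.EllipticCurves.ModularForms
open Literature.NumberTheory.GaloisRepresentations
open Summit.BirchSwinnertonDyer.BirchSwinnertonDyer.Theses.QuadraticBranchSignedControl

namespace Summit.BirchSwinnertonDyer.BirchSwinnertonDyer.Theorems

namespace EulerSystemBound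

/-- **Item 19584 `PublishedInputThm74` (Kobayashi Thm. 7.4 at `η`) from the zeta-pinned fact `hZ`**:
project `hZ` onto k8q-c3's `thm62_63_73_etaColemanPoitouTate` (the structure binders of `T_pW` are tree
theorems) and apply the tree's `Thm74Skeleton.publishedInputThm74_of_etaColemanPoitouTate`. CONDITIONAL
on `hZ`; 19584 stays held. [cite: Kobayashi2003, Thm. 7.4 and its proof (p. 13)] -/
theorem publishedInputThm74_of_zeta (hZ : Kobayashi2003.thm62_63_73_etaColemanPoitouTate_zeta) :
    PublishedInputThm74 := by
  have h : Kobayashi2003.thm62_63_73_etaColemanPoitouTate := by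
    intro p _ K₀ _ _ _ _ η hηK hη1 V _ _ N _ f hp hgood hap hf ϖ hϖ κ γ hκ hγ hγK hγc W _ _ C hC I FB
    haveI : Module.Free ℤ_[p] (W.tateModule p) := W.module_free_tateModule_holds p
    haveI : Module.Finite ℤ_[p] (W.tateModule p) := W.module_finite_tateModule_holds p
    obtain ⟨E⟩ := hZ p K₀ η hηK hη1 V hp hgood hap hf ϖ hϖ κ γ hκ hγ hγK hγc W C hC I FB
    exact ⟨E.toEtaColemanPoitouTateData⟩
  exact Thm74Skeleton.publishedInputThm74_of_etaColemanPoitouTate h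

/-- **The crux 19115 `EtaTransportSigned` from the zeta-pinned fact `hZ` alone** (projection to
k8q-c3's fact, then the tree's `Thm74Skeleton.etaTransportSigned_of_etaColemanPoitouTate` = glue 19585 ∘
the proved child 19583). CONDITIONAL on `hZ`; 19115 stays settled-by-citation at 19584.
[cite: Kobayashi2003, Thm. 7.4 and its proof (p. 13), §4 (p. 8)] -/
theorem etaTransportSigned_of_zeta (hZ : Kobayashi2003.thm62_63_73_etaColemanPoitouTate_zeta) :
    EtaTransportSigned := by
  have h : Kobayashi2003.thm62_63_73_etaColemanPoitouTate := by
    intro p _ K₀ _ _ _ _ η hηK hη1 V _ _ N _ f hp hgood hap hf ϖ hϖ κ γ hκ hγ hγK hγc W _ _ C hC I FB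
    haveI : Module.Free ℤ_[p] (W.tateModule p) := W.module_free_tateModule_holds p
    haveI : Module.Finite ℤ_[p] (W.tateModule p) := W.module_finite_tateModule_holds p
    obtain ⟨E⟩ := hZ p K₀ η hηK hη1 V hp hgood hap hf ϖ hϖ κ γ hκ hγ hγK hγc W C hC I FB
    exact ⟨E.toEtaColemanPoitouTateData⟩
  exact Thm74Skeleton.etaTransportSigned_of_etaColemanPoitouTate h

/-- **The rung leaf K8 `O5SharpGss` from named facts + the route's OPEN cruxes only.** Hypotheses:
the three Literature facts `hZ` (Kobayashi Thm. 6.2/6.3/7.3 i)/Cor. 7.2 at `η`, `z` an Euler-system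
class), `h134` (Kato Thm. 13.4 for `T_pW`, reduction-free), `h12` (Kobayashi Thm. 1.2); the open crux
items `hE` (19242, Eisenstein inclusion on the tower-onto locus), `hN` (19243, the non-surjective
residual), `h₄` (19116, `p`-adic Gross–Zagier on the minus branch); the held published inputs `hP`
(19082), `hKO` (Kitajima–Otsuki Main Thm. 1.3, 19301) and the declared `p = 3` residual `hR` (19120).
Discharged BY NAME relative to `closes`: `hK` (item 19241, on the rows `closes` uses it:
`plusKatoDivisibilityBranch_onto`), `h₂` (item 19115: `etaTransportSigned_of_zeta`), `hG` (support
19119: `gss2Assembly_proof`). CONDITIONAL; closes nothing; BSD for no curve.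
[cite: Kobayashi2003, Thm. 1.2 (p. 2), Thm. 4.1 (p. 8), Thm. 7.4 (p. 13)] [cite: Kato2004Asterisque, Thm. 13.4 (p. 226)]
[cite: KitajimaOtsuki2018, Main Thm. 1.3] -/
theorem o5SharpGss_of_facts_of_cruxes
    (hZ : Kobayashi2003.thm62_63_73_etaColemanPoitouTate_zeta)
    (h134 : Kato2004.thm13_4_lengthAt_fineSelmerDual_le_of_isEulerSystemClass)
    (h12 : Kobayashi2003.thm12_signedSelmerDual_finite_torsion)
    (hE : PlusLowerInclusionSurjBranch) (hN : PlusMainConjectureNonsurjBranch)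
    (h₄ : PAdicGrossZagierBranch) (hP : PublishedInputsGss2) (hKO : PublishedInputKO13)
    (hR : Gss2AtThree) :
    Summit.BirchSwinnertonDyer.Rank1Residual.Additive.O5SharpGss :=
  o5SharpGss_of_onto (plusKatoDivisibilityBranch_onto hZ h134 h12) hE hN (etaTransportSigned_of_zeta hZ)
    h₄ hP hKO gss2Assembly_proof hR

end EulerSystemBound

end Summit.BirchSwinnertonDyer.BirchSwinnertonDyer.Theorems

end
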